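import Summits.AtomisticToContinuum.HydrodynamicLimit.Theses.LambertianContactSwap
import Summits.AtomisticToContinuum.HydrodynamicLimit.Theorems.LambertianContactSwapSwapGapEntropyTransfer
import Literature.MathematicalPhysics.KineticTheory.LambertianHardSphereFlow
import HarnessLib

/-!
# Crux-strategist sketch — `LambertianContactSwap.SwapGap` (stmt-AtomisticToContinuum-11850)

planner-cstrat-stmt-AtomisticToContinuum-11850-s1-0, 2026-08-17.

Four groups of typed objects used by the strategist's outputs:

1. `RelEntSwap`, `FieldConcentrationLambda` — the two children of the DECOMPOSITION filed with
   `ledger route edit --split SwapGap --into RelEntSwap FieldConcentrationLambda --glue-by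
   Summit.AtomisticToContinuum.HydrodynamicLimit.Theorems.swapGap_of_relEntSwap_of_fieldConcentration`
   (verbatim the registered research stubs S1 `stub_relEntSwap`, S2 `stub_fieldConcentration` of the
   live line `Sketch`, written with fully qualified constants); `split_glue` certifies that the
   LANDED composition (p106427 lineage, `Theorems/LambertianContactSwapSwapGapEntropyTransfer.lean`)
   has exactly the type `RelEntSwap → FieldConcentrationLambda → SwapGap`.
2. `PairDirectionIsotropy` — first lemma of the crux idea `pair-isotropy-lindeberg` (lens: transfer):
   the incoming-relative-direction isotropy of the deterministic gas at contacts, the second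
   two-body contact statistic (besides `ContactAngleEquidistribution`, stmt-12097) that the route's
   NATIVE Lindeberg split consumes; typed after stmt-12097's pattern, frame-free (ĝ is Galilean
   invariant), exact in equilibrium for every `N`.
3. `SwapGapInBand` — the packing-guarded form of the crux (census §Negation: the crux is unguarded,
   the summit conjunct is guarded since D-0032), with `swapGapInBand_of_swapGap` (it is weaker) and
   `closes_of_inBand` (it still decides the conjunct together with `LambertianEuler`): evidence for
   the tenure planner that a guarded restatement loses nothing.
4. `ForcingVanishes`, `ContactDirectionEquidistribution`, `HybridNonAccumulation` — the typed statements of the native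
   Lindeberg line worked out and withdrawn this session (census §D3), kept sorry-free for the next crux-plan seat.
-/

noncomputable section

namespace Summit.AtomisticToContinuum.HydrodynamicLimit.Cruxes.SwapGap.Strategist

open scoped BigOperators Topology Classical MeasureTheory ProbabilityTheory ENNReal
open Filter Set Function MeasureTheory
open Summit.AtomisticToContinuum.HydrodynamicLimit.Theses.LambertianContactSwap

/-! ## 1. The decomposition children (verbatim S1, S2 of line `Sketch`) -/

/-- S1 = `RelEntSwap`: pre-shock, `KL((Φ_t)_* P_N ‖ (Λ_t)_*(P_N ⊗ γ^ℕ))/(N+1) → 0`. -/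
def RelEntSwap : Prop :=
  ∀ (a₀ θ₀ : Literature.MathematicalPhysics.KineticTheory.T3 → ℝ) (u₀ : Literature.MathematicalPhysics.KineticTheory.T3 → Literature.MathematicalPhysics.KineticTheory.V3), Continuous a₀ → Continuous θ₀ → Continuous u₀ → (∀ x, 0 < a₀ x) → (∀ x, 0 < θ₀ x) → ∃ σ₀ : ℝ, 0 < σ₀ ∧ ∀ σ : ℝ, 0 < σ → σ < σ₀ → ∀ (T : ℝ) (ρ θ : ℝ → Literature.MathematicalPhysics.KineticTheory.T3 → ℝ) (u : ℝ → Literature.MathematicalPhysics.KineticTheory.T3 → Literature.MathematicalPhysics.KineticTheory.V3), Literature.MathematicalPhysics.KineticTheory.IsHardSphereEulerSolution σ T ρ u θ → ∀ Φ : (N : ℕ) → Literature.Analysis.FluidPDE.HardSphereFlow (Literature.Analysis.FluidPDE.Torus.geometry (Fin 3)) (Literature.MathematicalPhysics.KineticTheory.hsDiameter σ N) (N + 1), Literature.MathematicalPhysics.KineticTheory.TendstoHydroFieldsAt (fun N => Literature.MathematicalPhysics.KineticTheory.localGibbsLaw σ a₀ u₀ θ₀ N (Φ N)) Φ ρ u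 θ 0 → ∀ t ∈ Set.Ico 0 T, Filter.Tendsto (fun N : ℕ => InformationTheory.klDiv ((Literature.MathematicalPhysics.KineticTheory.localGibbsLaw σ a₀ u₀ θ₀ N (Φ N)).map ((Φ N).flow t)) (((Literature.MathematicalPhysics.KineticTheory.localGibbsLaw σ a₀ u₀ θ₀ N (Φ N)).prod (Literature.MathematicalPhysics.KineticTheory.lambertNoise (Fin 3))).map (fun p => Literature.MathematicalPhysics.KineticTheory.lambertFlow (Literature.Analysis.FluidPDE.Torus.geometry (Fin 3)) (Literature.MathematicalPhysics.KineticTheory.hsDiameter σ N) p.2 p.1 t)) / ((N : ENNReal) + 1)) Filter.atTop (nhds 0)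

/-- S2 = `FieldConcentrationLambda`: pre-shock, speed-`N` self-averaging of every bounded
`1`-Lipschitz statistic of the `χ`-tested field triple of `Λ_t` about its own mean. -/
def FieldConcentrationLambda : Prop :=
  ∀ (a₀ θ₀ : Literature.MathematicalPhysics.KineticTheory.T3 → ℝ) (u₀ : Literature.MathematicalPhysics.KineticTheory.T3 → Literature.MathematicalPhysics.KineticTheory.V3), Continuous a₀ → Continuous θ₀ → Continuous u₀ → (∀ x, 0 < a₀ x) → (∀ x, 0 < θ₀ x) → ∃ σ₀ : ℝ, 0 < σ₀ ∧ ∀ σ : ℝ, 0 < σ → σ < σ₀ → ∀ (T : ℝ) (ρ θ : ℝ → Literature.MathematicalPhysics.KineticTheory.T3 → ℝ) (u : ℝ → Literature.MathematicalPhysics.KineticTheory.T3 → Literature.MathematicalPhysics.KineticTheory.V3), Literature.MathematicalPhysics.KineticTheory.IsHardSphereEulerSolution σ T ρ u θ → ∀ Φ : (N : ℕ) → Literature.Analysis.FluidPDE.HardSphereFlow (Literature.Analysis.FluidPDE.Torus.geometry (Fin 3)) (Literature.MathematicalPhysics.KineticTheory.hsDiameter σ N) (N + 1), Literature.MathematicalPhysics.KineticTheory.TendstoHydroFieldsAt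 (fun N => Literature.MathematicalPhysics.KineticTheory.localGibbsLaw σ a₀ u₀ θ₀ N (Φ N)) Φ ρ u θ 0 → ∀ t ∈ Set.Ico 0 T, ∀ χ : Literature.MathematicalPhysics.KineticTheory.T3 → ℝ, Continuous χ → ∀ F : ℝ × Literature.MathematicalPhysics.KineticTheory.V3 × ℝ → ℝ, LipschitzWith 1 F → (∀ y, |F y| ≤ 1) → ∀ δ : ℝ, 0 < δ → ∃ C : ℝ, 0 < C ∧ ∀ N : ℕ, ((Literature.MathematicalPhysics.KineticTheory.localGibbsLaw σ a₀ u₀ θ₀ N (Φ N)).prod (Literature.MathematicalPhysics.KineticTheory.lambertNoise (Fin 3))) {p | δ < |F (Literature.MathematicalPhysics.KineticTheory.empiricalDensityField (Literature.MathematicalPhysics.KineticTheory.lambertFlow (Literature.Analysis.FluidPDE.Torus.geometry (Fin 3)) (Literature.MathematicalPhysics.KineticTheory.hsDiameter σ N) p.2 p.1 t) χ, Literature.MathematicalPhysics.KineticTheory.empiricalMomentumField (Literature.MathematicalPhysics.KineticTheory.lambertFlow (Literature.Analysis.FluidPDE.Torus.geometry (Fin 3)) (Literature.MathematicalPhysics.KineticTheory.hsDiameter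 σ N) p.2 p.1 t) χ, Literature.MathematicalPhysics.KineticTheory.empiricalEnergyField (Literature.MathematicalPhysics.KineticTheory.lambertFlow (Literature.Analysis.FluidPDE.Torus.geometry (Fin 3)) (Literature.MathematicalPhysics.KineticTheory.hsDiameter σ N) p.2 p.1 t) χ) - ∫ q, F (Literature.MathematicalPhysics.KineticTheory.empiricalDensityField (Literature.MathematicalPhysics.KineticTheory.lambertFlow (Literature.Analysis.FluidPDE.Torus.geometry (Fin 3)) (Literature.MathematicalPhysics.KineticTheory.hsDiameter σ N) q.2 q.1 t) χ, Literature.MathematicalPhysics.KineticTheory.empiricalMomentumField (Literature.MathematicalPhysics.KineticTheory.lambertFlow (Literature.Analysis.FluidPDE.Torus.geometry (Fin 3)) (Literature.MathematicalPhysics.KineticTheory.hsDiameter σ N) q.2 q.1 t) χ, Literature.MathematicalPhysics.KineticTheory.empiricalEnergyField (Literature.MathematicalPhysics.KineticTheory.lambertFlow (Literature.Analysis.FluidPDE.Torus.geometry (Fin 3)) (Literature.MathematicalPhysics.KineticTheory.hsDiameter σ N) q.2 q.1 t) χ) ∂((Literature.MathematicalPhysics.KineticTheory.localGibbsLaw σ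 a₀ u₀ θ₀ N (Φ N)).prod (Literature.MathematicalPhysics.KineticTheory.lambertNoise (Fin 3)))|} ≤ ENNReal.ofReal (C * Real.exp (-(C⁻¹ * ((N : ℝ) + 1))))

/-- **Glue certificate for the split.** The landed composition of line `Sketch` has exactly the
type `RelEntSwap → FieldConcentrationLambda → SwapGap` (term-mode, no tactic: the children are the
theorem's hypotheses up to the reducible abbreviations `T3`, `V3`). -/
theorem split_glue : RelEntSwap → FieldConcentrationLambda → SwapGap :=
  Summit.AtomisticToContinuum.HydrodynamicLimit.Theorems.swapGap_of_relEntSwap_of_fieldConcentration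

/-! ## 2. First lemma of idea `pair-isotropy-lindeberg`: incoming-direction isotropy at contacts -/

/-- **Pair-direction isotropy at contacts** (Φ-side input of the native Lindeberg split, the
companion of `ContactAngleEquidistribution`): for local Gibbs data, small `σ`, any `t ≥ 0` and any
test functions `ψ_N(s, x, c, r, n)` — measurable, `|ψ| ≤ 1`, `1`-Lipschitz in the unit vector `n`,
depending on a collision only through its instant `s`, midpoint `x`, centre-of-mass velocity
`c = (v + v*)/2` and relative speed `r = |v − v*|` — the normalised `|g|²`-weighted collision sum
`(N+1)^{-4/3} E_{P_N} Σ_{collisions k ≤ t} |g_k|² [ψ_N(t_k, x_k, c_k, |g_k|, ĝ_k) − ⨍_{S²} ψ_N(t_k,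
x_k, c_k, |g_k|, n) dn] → 0`, where `ĝ_k` is the direction of the incoming relative velocity of
the `k`-th collision of the library's deterministic construction and the sphere average is written
as a normalised standard Gaussian. Frame-free (relative velocities are Galilean invariant); exact
in equilibrium for every `N` (Maxwellian product: `c ⊥ g`, `g` isotropic, contact pair correlation
independent of velocities); out of equilibrium the Chapman–Enskog anisotropy of the contact pair
law is `O(Kn) = O(N^{-1/3})`. -/
def PairDirectionIsotropy : Prop :=
  let Cfg : ℕ → Type := fun N => Literature.Analysis.FluidPDE.Config (N + 1) (Fin 3) (UnitAddTorus (Fin 3)); let G := Literature.Analysis.FluidPDE.Torus.geometry (Fin 3); let ε : ℝ → ℕ → ℝ := Literature.MathematicalPhysics.KineticTheory.hsDiameter; let τ : ℝ → (N : ℕ) → Cfg N → ENNReal := fun σ N z => Literature.Analysis.FluidPDE.Alexander.freeExitTime G (ε σ N) z; let S : ℝ → (N : ℕ) → Cfg N → Cfg N := fun t _ z => Literature.Analysis.FluidPDE.freeFlight G t z; let zpre : ℝ → (N : ℕ) → Cfg N → ℕ → Cfg N := fun σ N z m => let y := Literature.Analysis.FluidPDE.Alexander.stateAfter G (ε σ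 N) z m; S (τ σ N y).toReal N y; let Kt : ℝ → (N : ℕ) → Cfg N → ℝ → ℕ := fun σ N z t => Literature.Analysis.FluidPDE.Alexander.collisionCount G (ε σ N) z t; let hit : ℝ → (N : ℕ) → Cfg N → Fin (N + 1) → Fin (N + 1) → Prop := fun σ N y i j => i < j ∧ y ∈ Literature.Analysis.FluidPDE.contactSet G (N + 1) (ε σ N) i j ∧ Literature.Analysis.FluidPDE.IsIncoming G y i j; let tcol : ℝ → (N : ℕ) → Cfg N → ℕ → ℝ := fun σ N z m => (Literature.Analysis.FluidPDE.Alexander.collisionInstant G (ε σ N) z (m + 1)).toReal; let xmid : (N : ℕ) → Cfg N → Fin (N + 1) → Fin (N + 1) → UnitAddTorus (Fin 3) := fun _ y i j => G.translate (y j).1 ((2 : ℝ)⁻¹ • G.sepVec (y i).1 (y j).1); ∀ (a₀ θ₀ : (UnitAddTorus (Fin 3)) → ℝ) (u₀ : (UnitAddTorus (Fin 3)) → EuclideanSpace ℝ (Fin 3)), Continuous a₀ → Continuous θ₀ → Continuous u₀ → (∀ x, 0 < a₀ x) → (∀ x, 0 < θ₀ x) → ∃ σ₀ : ℝ, 0 <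 σ₀ ∧ ∀ σ : ℝ, 0 < σ → σ < σ₀ → ∀ Φ : (N : ℕ) → Literature.Analysis.FluidPDE.HardSphereFlow G (ε σ N) (N + 1), let P := fun N => Literature.MathematicalPhysics.KineticTheory.localGibbsLaw σ a₀ u₀ θ₀ N (Φ N); ∀ t : ℝ, 0 ≤ t → ∀ ψ : ℕ → ℝ → (UnitAddTorus (Fin 3)) → EuclideanSpace ℝ (Fin 3) → ℝ → EuclideanSpace ℝ (Fin 3) → ℝ, (∀ N, Measurable (fun p : ℝ × (UnitAddTorus (Fin 3)) × (EuclideanSpace ℝ (Fin 3)) × ℝ × EuclideanSpace ℝ (Fin 3) => ψ N p.1 p.2.1 p.2.2.1 p.2.2.2.1 p.2.2.2.2)) → (∀ N s x c r n, |ψ N s x c r n| ≤ 1) → (∀ N s x c r (n n' : EuclideanSpace ℝ (Fin 3)), ‖n‖ = 1 → ‖n'‖ = 1 → |ψ N s x c r n - ψ N s x c r n'| ≤ ‖n - n'‖) → Filter.Tendsto (fun N : ℕ => ∫ z, ((N : ℝ) + 1) ^ (-(4 / 3 : ℝ)) * ∑ m ∈ Finset.range (Kt σ N z t), ∑ i :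 Fin (N + 1), ∑ j : Fin (N + 1), (let y := zpre σ N z m; if hit σ N y i j then ‖(y i).2 - (y j).2‖ ^ 2 * (ψ N (tcol σ N z m) (xmid N y i j) ((2 : ℝ)⁻¹ • ((y i).2 + (y j).2)) ‖(y i).2 - (y j).2‖ (‖(y i).2 - (y j).2‖⁻¹ • ((y i).2 - (y j).2)) - ∫ ξ, ψ N (tcol σ N z m) (xmid N y i j) ((2 : ℝ)⁻¹ • ((y i).2 + (y j).2)) ‖(y i).2 - (y j).2‖ (‖ξ‖⁻¹ • ξ) ∂(ProbabilityTheory.stdGaussian (EuclideanSpace ℝ (Fin 3)))) else 0) ∂(P N)) Filter.atTop (nhds 0)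

/-! ## 3. The packing-guarded form of the crux -/

/-- `SwapGapInBand`: the crux with the summit conjunct's packing guard — an outermost threshold
`η₀ > 0` and the hypothesis `∀ t ∈ [0,T), ∀ x, ρ_t(x) σ³ < η₀` on the classical Euler solution —
and otherwise verbatim (Lambertian flow via the named Literature API, definitionally the crux's
inline `let` block). -/
def SwapGapInBand : Prop :=
  ∃ η₀ : ℝ, 0 < η₀ ∧ ∀ (a₀ θ₀ : (UnitAddTorus (Fin 3)) → ℝ) (u₀ : (UnitAddTorus (Fin 3)) → EuclideanSpace ℝ (Fin 3)), Continuous a₀ → Continuous θ₀ → Continuous u₀ → (∀ x, 0 < a₀ x) → (∀ x, 0 < θ₀ x) → ∃ σ₀ : ℝ, 0 < σ₀ ∧ ∀ σ : ℝ, 0 < σ → σ < σ₀ → ∀ (T : ℝ) (ρ θ : ℝ → (UnitAddTorus (Fin 3)) → ℝ) (u : ℝ → (UnitAddTorus (Fin 3)) → EuclideanSpace ℝ (Fin 3)), Literature.MathematicalPhysics.KineticTheory.IsHardSphereEulerSolution σ T ρ u θ → (∀ t ∈ Set.Ico 0 T, ∀ x, ρ t x * σ ^ 3 < η₀) → ∀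 Φ : (N : ℕ) → Literature.Analysis.FluidPDE.HardSphereFlow (Literature.Analysis.FluidPDE.Torus.geometry (Fin 3)) (Literature.MathematicalPhysics.KineticTheory.hsDiameter σ N) (N + 1), let P := fun N => Literature.MathematicalPhysics.KineticTheory.localGibbsLaw σ a₀ u₀ θ₀ N (Φ N); Literature.MathematicalPhysics.KineticTheory.TendstoHydroFieldsAt P Φ ρ u θ 0 → ∀ t ∈ Set.Ico 0 T, ∀ χ : (UnitAddTorus (Fin 3)) → ℝ, Continuous χ → ∀ F : ℝ × (EuclideanSpace ℝ (Fin 3)) × ℝ → ℝ, LipschitzWith 1 F → (∀ y, |F y| ≤ 1) → Filter.Tendsto (fun N : ℕ => (∫ z, F (Literature.MathematicalPhysics.KineticTheory.empiricalDensityField ((Φ N).flow t z) χ, Literature.MathematicalPhysics.KineticTheory.empiricalMomentumField ((Φ N).flow t z) χ, Literature.MathematicalPhysics.KineticTheory.empiricalEnergyField ((Φ N).flow t z) χ) ∂(P N)) - ∫ p, F (Literature.MathematicalPhysics.KineticTheory.empiricalDensityField (Literature.MathematicalPhysics.KineticTheory.lambertFlow (Literature.Analysis.FluidPDE.Torus.geometry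 (Fin 3)) (Literature.MathematicalPhysics.KineticTheory.hsDiameter σ N) p.2 p.1 t) χ, Literature.MathematicalPhysics.KineticTheory.empiricalMomentumField (Literature.MathematicalPhysics.KineticTheory.lambertFlow (Literature.Analysis.FluidPDE.Torus.geometry (Fin 3)) (Literature.MathematicalPhysics.KineticTheory.hsDiameter σ N) p.2 p.1 t) χ, Literature.MathematicalPhysics.KineticTheory.empiricalEnergyField (Literature.MathematicalPhysics.KineticTheory.lambertFlow (Literature.Analysis.FluidPDE.Torus.geometry (Fin 3)) (Literature.MathematicalPhysics.KineticTheory.hsDiameter σ N) p.2 p.1 t) χ) ∂((P N).prod (Literature.MathematicalPhysics.KineticTheory.lambertNoise (Fin 3)))) Filter.atTop (nhds 0)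

/-- The guarded form is WEAKER than the crux (ignore the guard; the inline `let` block of
`SwapGap` is the named API by `rfl`). -/
theorem swapGapInBand_of_swapGap (hS : SwapGap) : SwapGapInBand := by
  refine ⟨1, one_pos, ?_⟩
  intro a₀ θ₀ u₀ ha hθ hu ha0 hθ0
  obtain ⟨σ₀, hσ₀, H⟩ := hS a₀ θ₀ u₀ ha hθ hu ha0 hθ0
  refine ⟨σ₀, hσ₀, ?_⟩
  intro σ hσ hσ' T ρ θ u hE _hη Φ P h0 t ht χ hχ F hF hF1
  exact H σ hσ hσ' T ρ θ u hE Φ h0 t ht χ hχ F hF hF1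

set_option maxHeartbeats 1600000 in
/-- **The guarded form still decides the conjunct** (with `LambertianEuler`): the proof of the
route's `closes`, with the packing threshold `η₀` taken from `SwapGapInBand` instead of `1` and the
guard hypothesis passed to it instead of being discarded. Evidence for a guarded restatement. -/
theorem closes_of_inBand (hS : SwapGapInBand) (hL : LambertianEuler) : _root_.HydrodynamicLimit := by
  obtain ⟨η₀, hη₀, hS⟩ := hS
  refine ⟨η₀, hη₀, ?_⟩ -- packing threshold from the guarded crux
  intro a₀ θ₀ u₀ ha hθ hu ha0 hθ0
  obtain ⟨σS, hσS, hS'⟩ := hS a₀ θ₀ u₀ ha hθ hu ha0 hθ0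
  obtain ⟨σL, hσL, hL'⟩ := hL a₀ θ₀ u₀ ha hθ hu ha0 hθ0
  refine ⟨min σS σL, lt_min hσS hσL, ?_⟩
  intro σ hσ hσlt T ρ θ u hE hη Φ h0 t ht χ hχ δ hδ -- `hη`: packing guard, now USED
  have hSw := hS' σ hσ (hσlt.trans_le (min_le_left _ _)) T ρ θ u hE hη Φ h0 t ht χ hχ
  have hLa := hL' σ hσ (hσlt.trans_le (min_le_right _ _)) T ρ θ u hE Φ h0 t ht χ hχ
  clear hS' hL'
  -- abstract merging transfer: finite `μ n`, measurable real `X n`, arbitrary real `Y n`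
  have key : ∀ {α β : ℕ → Type} [∀ n, MeasurableSpace (α n)] [∀ n, MeasurableSpace (β n)]
      (μ : ∀ n, Measure (α n)) (ν : ∀ n, Measure (β n)), (∀ n, IsFiniteMeasure (μ n)) →
      ∀ (X : ∀ n, α n → ℝ) (Y : ∀ n, β n → ℝ), (∀ n, Measurable (X n)) →
      (∀ g : ℝ → ℝ, LipschitzWith 1 g → (∀ y, |g y| ≤ 1) →
        Tendsto (fun n => (∫ z, g (X n z) ∂μ n) - ∫ p, g (Y n p) ∂ν n) atTop (𝓝 0)) →
      (∀ δ' : ℝ, 0 < δ' → Tendsto (fun n => ν n {p | δ' < Y n p}) atTop (𝓝 0)) →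
      ∀ δ' : ℝ, 0 < δ' → Tendsto (fun n => μ n {z | δ' < X n z}) atTop (𝓝 0) := by
    intro α β _ _ μ ν hμ X Y hX hswap hY δ hδ
    obtain ⟨g, hgl, hga, hg0, hg1, hgz, hgδ⟩ : ∃ g : ℝ → ℝ, LipschitzWith 1 g ∧ (∀ x, |g x| ≤ 1) ∧
        (∀ x, 0 ≤ g x) ∧ (∀ x, g x ≤ 1) ∧ (∀ x, x ≤ δ / 2 → g x = 0) ∧
        (∀ x, δ < x → min 1 (δ / 2) ≤ g x) := by
      have hnn : ∀ x : ℝ, 0 ≤ min 1 (max (x - δ / 2) 0) :=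
        fun x => le_min zero_le_one (le_max_right _ _)
      refine ⟨fun x => min 1 (max (x - δ / 2) 0), ?_, ?_, hnn, fun x => min_le_left _ _, ?_, ?_⟩
      · refine LipschitzWith.mk_one fun x y => ?_
        rw [Real.dist_eq, Real.dist_eq]
        calc |min 1 (max (x - δ / 2) 0) - min 1 (max (y - δ / 2) 0)|
            ≤ max |(1 : ℝ) - 1| |max (x - δ / 2) 0 - max (y - δ / 2) 0| :=
              abs_min_sub_min_le_max _ _ _ _
          _ = |max (x - δ / 2) 0 - max (y - δ / 2) 0| := by
              rw [sub_self, abs_zero, max_eq_right (abs_nonneg _)]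
          _ ≤ |x - δ / 2 - (y - δ / 2)| := abs_max_sub_max_le_abs _ _ _
          _ = |x - y| := by rw [sub_sub_sub_cancel_right]
      · exact fun x => by rw [abs_of_nonneg (hnn x)]; exact min_le_left _ _
      · exact fun x hx => show min 1 (max (x - δ / 2) 0) = 0 by
          rw [max_eq_right (sub_nonpos.2 hx), min_eq_right zero_le_one]
      · exact fun x hx => le_min (min_le_left _ _)
          ((min_le_right _ _).trans (le_max_of_le_left (by linarith)))
    have hκ : 0 < min 1 (δ / 2) := lt_min one_pos (half_pos hδ)
    have hb0 : ∀ n, 0 ≤ ∫ p, g (Y n p) ∂ν n := fun n => integral_nonneg fun p => hg0 _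
    have hb_le : ∀ n, ENNReal.ofReal (∫ p, g (Y n p) ∂ν n) ≤ ν n {p | δ / 2 < Y n p} := by
      intro n
      have h1 : ENNReal.ofReal (∫ p, g (Y n p) ∂ν n) ≤ ∫⁻ p, ENNReal.ofReal (g (Y n p)) ∂ν n := by
        by_cases hf : Integrable (fun p => g (Y n p)) (ν n)
        · rw [ofReal_integral_eq_lintegral_ofReal hf (Eventually.of_forall fun p => hg0 _)]
        · rw [integral_undef hf, ENNReal.ofReal_zero]
          exact zero_le
      refine h1.trans ((lintegral_mono fun p => ?_).trans (lintegral_indicator_one_le _))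
      by_cases hp : δ / 2 < Y n p
      · rw [Set.indicator_of_mem (show p ∈ {p | δ / 2 < Y n p} from hp), Pi.one_apply]
        exact ENNReal.ofReal_le_one.2 (hg1 _)
      · rw [Set.indicator_of_notMem (show p ∉ {p | δ / 2 < Y n p} from hp),
          hgz _ (not_lt.1 hp), ENNReal.ofReal_zero]
    have hb : Tendsto (fun n => ∫ p, g (Y n p) ∂ν n) atTop (𝓝 0) := by
      have h1 : Tendsto (fun n => ENNReal.ofReal (∫ p, g (Y n p) ∂ν n)) atTop (𝓝 0) :=
        tendsto_of_tendsto_of_tendsto_of_le_of_le tendsto_const_nhds (hY _ (half_pos hδ))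
          (fun n => zero_le) hb_le
      exact ((ENNReal.tendsto_toReal_zero_iff (fun n => ENNReal.ofReal_ne_top)).2 h1).congr
        fun n => ENNReal.toReal_ofReal (hb0 n)
    have ha : Tendsto (fun n => ∫ z, g (X n z) ∂μ n) atTop (𝓝 0) := by
      simpa using (hswap g hgl hga).add hb
    have hA : ∀ n, MeasurableSet {z | δ < X n z} :=
      fun n => measurableSet_lt measurable_const (hX n)
    have ha_ge : ∀ n, min 1 (δ / 2) * (μ n {z | δ < X n z}).toReal ≤ ∫ z, g (X n z) ∂μ n := by
      intro n
      haveI := hμ n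
      have hint : Integrable (fun z => g (X n z)) (μ n) :=
        Integrable.of_bound (hgl.continuous.measurable.comp (hX n)).aestronglyMeasurable 1
          (Eventually.of_forall fun z => by rw [Real.norm_eq_abs]; exact hga (X n z))
      calc min 1 (δ / 2) * (μ n {z | δ < X n z}).toReal
          = ∫ z, {z | δ < X n z}.indicator (fun _ => min 1 (δ / 2)) z ∂μ n := by
            rw [integral_indicator_const _ (hA n), smul_eq_mul, measureReal_def, mul_comm]
        _ ≤ ∫ z, g (X n z) ∂μ n := by
            refine integral_mono ((integrable_const _).indicator (hA n)) hint fun z => ?_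
            by_cases hz : δ < X n z
            · rw [Set.indicator_of_mem (show z ∈ {z | δ < X n z} from hz)]
              exact hgδ _ hz
            · rw [Set.indicator_of_notMem (show z ∉ {z | δ < X n z} from hz)]
              exact hg0 _
    refine (ENNReal.tendsto_toReal_zero_iff fun n => ?_).1 ?_
    · haveI := hμ n
      exact measure_ne_top _ _
    have h0 : Tendsto (fun n => (min 1 (δ / 2))⁻¹ * ∫ z, g (X n z) ∂μ n) atTop (𝓝 0) := by
      simpa using ha.const_mul (min 1 (δ / 2))⁻¹
    refine tendsto_of_tendsto_of_tendsto_of_le_of_le tendsto_const_nhds h0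
      (fun n => ENNReal.toReal_nonneg) fun n => ?_
    rw [le_inv_mul_iff₀ hκ]
    exact ha_ge n
  -- local Gibbs laws are finite for all `σ, N`: `1_D f₀^⊗(N+1)` integrable, or `𝒵 = 0` (zero law)
  have aux : ∀ {α : Type} [MeasureSpace α] (f : α → ℝ) (s : Set α),
      ∫⁻ z in s, ENNReal.ofReal ((∫ z, f z)⁻¹ * f z) < ⊤ := by
    intro α _ f s
    by_cases hint : Integrable f volume
    · exact lt_of_le_of_lt (lintegral_mono' Measure.restrict_le_self fun z => Real.ofReal_le_enorm _)
        (hasFiniteIntegral_iff_enorm.1 (hint.const_mul _).hasFiniteIntegral)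
    · simp [integral_undef hint]
  have hfinP : ∀ N, IsFiniteMeasure (Literature.MathematicalPhysics.KineticTheory.localGibbsLaw σ a₀ u₀ θ₀ N (Φ N)) := fun N =>
    ⟨by
      show (volume.restrict _).withDensity _ Set.univ < ⊤
      rw [withDensity_apply _ MeasurableSet.univ, Measure.restrict_univ]
      exact aux _ _⟩
  -- measurability of the empirical fields (finite averages, `χ` continuous)
  have hpos : ∀ {N : ℕ} (i : Fin (N + 1)),
      Measurable fun z : Literature.Analysis.FluidPDE.Config (N + 1) (Fin 3) (UnitAddTorus (Fin 3)) => (z i).1 :=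
    fun i => (measurable_pi_apply i).fst
  have hvel : ∀ {N : ℕ} (i : Fin (N + 1)),
      Measurable fun z : Literature.Analysis.FluidPDE.Config (N + 1) (Fin 3) (UnitAddTorus (Fin 3)) => (z i).2 :=
    fun i => (measurable_pi_apply i).snd
  have hmD : ∀ N, Measurable fun z => Literature.MathematicalPhysics.KineticTheory.empiricalDensityField (N := N + 1) z χ := by
    intro N
    rw [show (fun z => Literature.MathematicalPhysics.KineticTheory.empiricalDensityField (N := N + 1) z χ) =
        fun z => ((N + 1 : ℕ) : ℝ)⁻¹ * ∑ i, χ (z i).1 from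
      funext fun z => Literature.Analysis.FluidPDE.integral_empiricalMeasure z fun y => χ y.1]
    exact measurable_const.mul (Finset.measurable_sum _ fun i _ => hχ.measurable.comp (hpos i))
  have hmM : ∀ N, Measurable fun z => Literature.MathematicalPhysics.KineticTheory.empiricalMomentumField (N := N + 1) z χ := by
    intro N
    have heq : (fun z => Literature.MathematicalPhysics.KineticTheory.empiricalMomentumField (N := N + 1) z χ) =
        fun z => (((N + 1 : ℕ) : ENNReal)⁻¹).toReal • ∑ i, χ (z i).1 • (z i).2 := by
      funext z
      show ∫ y, χ y.1 • y.2 ∂(Literature.Analysis.FluidPDE.empiricalMeasure z) = _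
      rw [Literature.Analysis.FluidPDE.empiricalMeasure_eq, integral_smul_measure,
        integral_finsetSum_measure fun i _ => integrable_dirac enorm_lt_top]
      simp only [integral_dirac]
    rw [heq]
    exact (Finset.measurable_sum Finset.univ fun i _ =>
      (hχ.measurable.comp (hpos i)).fun_smul (hvel i)).fun_const_smul _
  have hmE : ∀ N, Measurable fun z => Literature.MathematicalPhysics.KineticTheory.empiricalEnergyField (N := N + 1) z χ := by
    intro N
    rw [show (fun z => Literature.MathematicalPhysics.KineticTheory.empiricalEnergyField (N := N + 1) z χ) =
        fun z => ((N + 1 : ℕ) : ℝ)⁻¹ * ∑ i, χ (z i).1 * (‖(z i).2‖ ^ 2 / 2) from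
      funext fun z => Literature.Analysis.FluidPDE.integral_empiricalMeasure z fun y => χ y.1 * (‖y.2‖ ^ 2 / 2)]
    exact measurable_const.mul (Finset.measurable_sum _ fun i _ =>
      (hχ.measurable.comp (hpos i)).mul (((hvel i).norm.pow_const 2).div_const 2))
  -- `1`-Lipschitz maps do not increase distances; the elementary test functions
  have hdl : ∀ {α β : Type} [PseudoMetricSpace α] [PseudoMetricSpace β] (f : α → β),
      LipschitzWith 1 f → ∀ x y, dist (f x) (f y) ≤ dist x y :=
    fun f hf x y => by simpa using hf.dist_le_mul x y
  have habs : ∀ c : ℝ, LipschitzWith 1 fun x : ℝ => |x - c| :=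
    fun c => by simpa only [Real.dist_eq] using LipschitzWith.dist_left c
  have hnrm : ∀ c : (EuclideanSpace ℝ (Fin 3)), LipschitzWith 1 fun x : (EuclideanSpace ℝ (Fin 3)) => ‖x - c‖ :=
    fun c => by simpa only [dist_eq_norm] using LipschitzWith.dist_left c
  -- the three transfers (density, momentum, energy)
  refine ⟨?_, ?_, ?_⟩
  · exact key _ _ hfinP
      (fun N z => |Literature.MathematicalPhysics.KineticTheory.empiricalDensityField ((Φ N).flow t z) χ - ∫ x, χ x * ρ t x|) _
      (fun N => (((hmD N).comp ((Φ N).measurable_flow t)).sub measurable_const).abs)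
      (fun g hg hg1 => hSw (fun y => g |y.1 - _|) (LipschitzWith.mk_one fun y y' =>
        (hdl g hg _ _).trans <| (hdl _ (habs _) _ _).trans (hdl _ LipschitzWith.prod_fst y y'))
        fun y => hg1 _)
      (fun δ' hδ' => (hLa δ' hδ').1) δ hδ
  · exact key _ _ hfinP
      (fun N z => ‖Literature.MathematicalPhysics.KineticTheory.empiricalMomentumField ((Φ N).flow t z) χ - ∫ x, (χ x * ρ t x) • u t x‖) _
      (fun N => (((hmM N).comp ((Φ N).measurable_flow t)).sub measurable_const).norm)
      (fun g hg hg1 => hSw (fun y => g ‖y.2.1 - _‖) (LipschitzWith.mk_one fun y y' =>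
        (hdl g hg _ _).trans <| (hdl _ (hnrm _) _ _).trans <|
          (hdl _ LipschitzWith.prod_fst y.2 y'.2).trans (hdl _ LipschitzWith.prod_snd y y'))
        fun y => hg1 _)
      (fun δ' hδ' => (hLa δ' hδ').2.1) δ hδ
  · exact key _ _ hfinP (fun N z => |Literature.MathematicalPhysics.KineticTheory.empiricalEnergyField ((Φ N).flow t z) χ -
        ∫ x, χ x * Literature.MathematicalPhysics.KineticTheory.totalEnergyDensity (ρ t x) (u t x) (θ t x)|) _
      (fun N => (((hmE N).comp ((Φ N).measurable_flow t)).sub measurable_const).abs)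
      (fun g hg hg1 => hSw (fun y => g |y.2.2 - _|) (LipschitzWith.mk_one fun y y' =>
        (hdl g hg _ _).trans <| (hdl _ (habs _) _ _).trans <|
          (hdl _ LipschitzWith.prod_snd y.2 y'.2).trans (hdl _ LipschitzWith.prod_snd y y'))
        fun y => hg1 _)
      (fun δ' hδ' => (hLa δ' hδ').2.2) δ hδ


/-! ## 4. Typed statements of the (withdrawn) native Lindeberg line `pair-isotropy-lindeberg`

Sorry-free `Prop` definitions over the named APIs (`Alexander.*`, `lambert*`); see the idea card and STRATEGY-CENSUS §D3 for
why the Λ-side stub A2 is not typed here (termwise form false, in-expectation form vacuous until the response kernel is pinned). -/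

section NativeLine

open scoped InnerProductSpace
open Literature.Analysis.FluidPDE Literature.MathematicalPhysics.KineticTheory ProbabilityTheory

/-- **ForcingVanishes** — the first-order Lindeberg forcing of the deterministic collision sequence vanishes for every bounded
direction-Lipschitz response functional `Ψ_N(s, x, c, r, ω, n)` (`W`-weighted, `(N+1)^{-4/3}`-normalised collision sum of
`Ψ(…, ω_m, n_spec,m) − ∫ Ψ(…, ω_m, lambertDir ω_m ξ) dγ(ξ)`, `P_N`-expectation `→ 0`, local Gibbs data, small `σ`, every `t ≥ 0`). -/
def ForcingVanishes : Prop :=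
  let Cfg : ℕ → Type := fun N => Config (N + 1) (Fin 3) T3;
  let G := Torus.geometry (Fin 3);
  let ε : ℝ → ℕ → ℝ := hsDiameter;
  let τ : ℝ → (N : ℕ) → Cfg N → ENNReal := fun σ N z => Alexander.freeExitTime G (ε σ N) z;
  let zpre : ℝ → (N : ℕ) → Cfg N → ℕ → Cfg N := fun σ N z m => let y := Alexander.stateAfter G (ε σ N) z m; freeFlight G (τ σ N y).toReal y;
  let Kt : ℝ → (N : ℕ) → Cfg N → ℝ → ℕ := fun σ N z t => Alexander.collisionCount G (ε σ N) z t;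
  let hit : ℝ → (N : ℕ) → Cfg N → Fin (N + 1) → Fin (N + 1) → Prop := fun σ N y i j => i < j ∧ y ∈ contactSet G (N + 1) (ε σ N) i j ∧ IsIncoming G y i j;
  let tcol : ℝ → (N : ℕ) → Cfg N → ℕ → ℝ := fun σ N z m => (Alexander.collisionInstant G (ε σ N) z (m + 1)).toReal;
  let xmid : (N : ℕ) → Cfg N → Fin (N + 1) → Fin (N + 1) → T3 := fun _ y i j => G.translate (y j).1 ((2 : ℝ)⁻¹ • G.sepVec (y i).1 (y j).1);
  let omg : ℝ → (N : ℕ) → Cfg N → Fin (N + 1) → Fin (N + 1) → V3 := fun σ N y i j => (ε σ N)⁻¹ • G.sepVec (y i).1 (y j).1;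
  let cm : (N : ℕ) → Cfg N → Fin (N + 1) → Fin (N + 1) → V3 := fun _ y i j => (2 : ℝ)⁻¹ • ((y i).2 + (y j).2);
  let gv : (N : ℕ) → Cfg N → Fin (N + 1) → Fin (N + 1) → V3 := fun _ y i j => (y i).2 - (y j).2;
  let W : (N : ℕ) → Cfg N → Fin (N + 1) → Fin (N + 1) → ℝ := fun _ y i j => 1 + ‖(y i).2‖ ^ 2 + ‖(y j).2‖ ^ 2;
  let nspec : V3 → V3 → V3 := fun g ω => ‖g‖⁻¹ • g - (2 * ⟪‖g‖⁻¹ • g, ω⟫_ℝ) • ω;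
  let IsResp : (ℕ → ℝ → T3 → V3 → ℝ → V3 → V3 → ℝ) → Prop := fun Ψ => (∀ N, Measurable (fun p : ℝ × T3 × V3 × ℝ × V3 × V3 => Ψ N p.1 p.2.1 p.2.2.1 p.2.2.2.1 p.2.2.2.2.1 p.2.2.2.2.2)) ∧ (∀ N s x c r ω n, |Ψ N s x c r ω n| ≤ 1) ∧ (∀ N s x c r (ω ω' n n' : V3), ‖ω‖ = 1 → ‖ω'‖ = 1 → ‖n‖ = 1 → ‖n'‖ = 1 → |Ψ N s x c r ω n - Ψ N s x c r ω' n'| ≤ ‖ω - ω'‖ + ‖n - n'‖);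
  let Mdl : ℝ → (N : ℕ) → (ℕ → ℝ → T3 → V3 → ℝ → V3 → V3 → ℝ) → Cfg N → ℕ → ℝ := fun σ N Ψ z m => ((N : ℝ) + 1) ^ (-(4 / 3 : ℝ)) * ∑ i : Fin (N + 1), ∑ j : Fin (N + 1), (let y := zpre σ N z m; if hit σ N y i j then W N y i j * (Ψ N (tcol σ N z m) (xmid N y i j) (cm N y i j) ‖gv N y i j‖ (omg σ N y i j) (nspec (gv N y i j) (omg σ N y i j)) - ∫ ξ, Ψ N (tcol σ N z m) (xmid N y i j) (cm N y i j) ‖gv N y i j‖ (omg σ N y i j) (lambertDir (omg σ N y i j) ξ) ∂(stdGaussian V3)) else 0);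
  ∀ (a₀ θ₀ : T3 → ℝ) (u₀ : T3 → V3), Continuous a₀ → Continuous θ₀ → Continuous u₀ → (∀ x, 0 < a₀ x) → (∀ x, 0 < θ₀ x) → ∃ σ₀ : ℝ, 0 < σ₀ ∧ ∀ σ : ℝ, 0 < σ → σ < σ₀ → ∀ Φ : (N : ℕ) → HardSphereFlow G (ε σ N) (N + 1), let P := fun N => localGibbsLaw σ a₀ u₀ θ₀ N (Φ N); ∀ t : ℝ, 0 ≤ t → ∀ Ψ : ℕ → ℝ → T3 → V3 → ℝ → V3 → V3 → ℝ, IsResp Ψ → Tendsto (fun N : ℕ => ∫ z, ∑ m ∈ Finset.range (Kt σ N z t), Mdl σ N Ψ z m ∂(P N)) atTop (𝓝 0)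

/-- **ContactDirectionEquidistribution** (Φ-side research statement of the native line) — joint kinematic-isotropic
equidistribution of the two contact directions `(ĝ, ω)` of the deterministic gas given the scalar marks `(s, x, c, |g|)`,
`W`-weighted; factors as ContactAngleEquidistribution(`W`) ∘ PairDirectionIsotropy(`W`). -/
def ContactDirectionEquidistribution : Prop :=
  let Cfg : ℕ → Type := fun N => Config (N + 1) (Fin 3) T3;
  let G := Torus.geometry (Fin 3);
  let ε : ℝ → ℕ → ℝ := hsDiameter;
  let τ : ℝ → (N : ℕ) → Cfg N → ENNReal := fun σ N z => Alexander.freeExitTime G (ε σ N) z;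
  let zpre : ℝ → (N : ℕ) → Cfg N → ℕ → Cfg N := fun σ N z m => let y := Alexander.stateAfter G (ε σ N) z m; freeFlight G (τ σ N y).toReal y;
  let Kt : ℝ → (N : ℕ) → Cfg N → ℝ → ℕ := fun σ N z t => Alexander.collisionCount G (ε σ N) z t;
  let hit : ℝ → (N : ℕ) → Cfg N → Fin (N + 1) → Fin (N + 1) → Prop := fun σ N y i j => i < j ∧ y ∈ contactSet G (N + 1) (ε σ N) i j ∧ IsIncoming G y i j;
  let tcol : ℝ → (N : ℕ) → Cfg N → ℕ → ℝ := fun σ N z m => (Alexander.collisionInstant G (ε σ N) z (m + 1)).toReal;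
  let xmid : (N : ℕ) → Cfg N → Fin (N + 1) → Fin (N + 1) → T3 := fun _ y i j => G.translate (y j).1 ((2 : ℝ)⁻¹ • G.sepVec (y i).1 (y j).1);
  let omg : ℝ → (N : ℕ) → Cfg N → Fin (N + 1) → Fin (N + 1) → V3 := fun σ N y i j => (ε σ N)⁻¹ • G.sepVec (y i).1 (y j).1;
  let cm : (N : ℕ) → Cfg N → Fin (N + 1) → Fin (N + 1) → V3 := fun _ y i j => (2 : ℝ)⁻¹ • ((y i).2 + (y j).2);
  let gv : (N : ℕ) → Cfg N → Fin (N + 1) → Fin (N + 1) → V3 := fun _ y i j => (y i).2 - (y j).2;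
  let W : (N : ℕ) → Cfg N → Fin (N + 1) → Fin (N + 1) → ℝ := fun _ y i j => 1 + ‖(y i).2‖ ^ 2 + ‖(y j).2‖ ^ 2;
  let IsResp : (ℕ → ℝ → T3 → V3 → ℝ → V3 → V3 → ℝ) → Prop := fun Ψ => (∀ N, Measurable (fun p : ℝ × T3 × V3 × ℝ × V3 × V3 => Ψ N p.1 p.2.1 p.2.2.1 p.2.2.2.1 p.2.2.2.2.1 p.2.2.2.2.2)) ∧ (∀ N s x c r ω n, |Ψ N s x c r ω n| ≤ 1) ∧ (∀ N s x c r (ω ω' n n' : V3), ‖ω‖ = 1 → ‖ω'‖ = 1 → ‖n‖ = 1 → ‖n'‖ = 1 → |Ψ N s x c r ω n - Ψ N s x c r ω' n'| ≤ ‖ω - ω'‖ + ‖n - n'‖);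
  ∀ (a₀ θ₀ : T3 → ℝ) (u₀ : T3 → V3), Continuous a₀ → Continuous θ₀ → Continuous u₀ → (∀ x, 0 < a₀ x) → (∀ x, 0 < θ₀ x) → ∃ σ₀ : ℝ, 0 < σ₀ ∧ ∀ σ : ℝ, 0 < σ → σ < σ₀ → ∀ Φ : (N : ℕ) → HardSphereFlow G (ε σ N) (N + 1), let P := fun N => localGibbsLaw σ a₀ u₀ θ₀ N (Φ N); ∀ t : ℝ, 0 ≤ t → ∀ φ : ℕ → ℝ → T3 → V3 → ℝ → V3 → V3 → ℝ, IsResp φ → Tendsto (fun N : ℕ => ∫ z, ((N : ℝ) + 1) ^ (-(4 / 3 : ℝ)) * ∑ m ∈ Finset.range (Kt σ N z t), ∑ i : Fin (N + 1), ∑ j : Fin (N + 1), (let y := zpre σ N z m; if hit σ N y i j then W N y i j * (φ N (tcol σ N z m) (xmid N y i j) (cm N y i j) ‖gv N y i j‖ (‖gv N y i j‖⁻¹ • gv N y i j) (omg σ N y i j) - ∫ ξ, ∫ ξ', φ N (tcol σ N z m) (xmid N y i j) (cm N y i j) ‖gv N y i j‖ (‖ξ‖⁻¹ • ξ) (lambertDir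 (-(‖ξ‖⁻¹ • ξ)) ξ') ∂(stdGaussian V3) ∂(stdGaussian V3)) else 0) ∂(P N)) atTop (𝓝 0)

/-- **HybridNonAccumulation** — `γ^ℕ`-a.s. non-accumulation of the Lambertian continuation from every deterministic
post-collisional state, Liouville-a.e. (the hypothesis of `SwapIdentity`, stmt-12100, in integrable form). -/
def HybridNonAccumulation : Prop :=
  let Cfg : ℕ → Type := fun N => Config (N + 1) (Fin 3) T3;
  let G := Torus.geometry (Fin 3);
  let ε : ℝ → ℕ → ℝ := hsDiameter;
  let τ : ℝ → (N : ℕ) → Cfg N → ENNReal := fun σ N z => Alexander.freeExitTime G (ε σ N) z;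
  ∀ σ : ℝ, 0 < σ → σ < 2⁻¹ → ∀ N : ℕ, ∀ᵐ z ∂(liouville G (N + 1) (ε σ N)), ∀ m : ℕ, ∀ᵐ ξs ∂(lambertNoise (Fin 3)), ∑' k, τ σ N (lambertStateAfter G (ε σ N) ξs (Alexander.stateAfter G (ε σ N) z m) k) = ⊤

end NativeLine

end Summit.AtomisticToContinuum.HydrodynamicLimit.Cruxes.SwapGap.Strategist
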